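import Summits.Langlands.Langlands.Theorems.IrreducibilityBySelfDualityRegularAdjointLiftCMCentralCharacterInfinityType
import Summits.Langlands.Langlands.Theorems.IrreducibilityBySelfDualityRegularAdjointLiftCMCubeRootAlgebraic
import Literature.NumberTheory.Automorphic.SelfdualGL3AdjointLiftProofs
import Literature.NumberTheory.Automorphic.ReciprocityGLnRankOneProofs
import Literature.NumberTheory.Automorphic.GLOneArchParameterOfAlgebraicCharacter
import Literature.NumberTheory.Automorphic.BaseChangeArchimedeanCentralCharacter
import Literature.NumberTheory.Automorphic.ClozelPurityProofs
import HarnessLib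

/-!
# `AdjointLiftFromRegularTwist` (route `IrreducibilityBySelfDuality`, item stmt-Langlands-14725), proved

The glue item `AdjointLiftFromRegularTwist := RegularTwistCM → RegularAdjointLiftCM` of the route
`IrreducibilityBySelfDuality`: the crux `RegularTwistCM` (r3) feeds the `closes` hypothesis
`RegularAdjointLiftCM` (r2).  This file is the composition of the r2 lead's line
`nu-cubed-central-character` (`Cruxes/RegularAdjointLiftCM/Lines/nu-cubed-central-character.lean`) with
its three stubs, all LANDED:

* `Summit.Langlands.Langlands.Theorems.RegularAdjointLiftCM.stub_centralCharacterInfinityType` (the central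
  character of a `π` with an infinity type of integral `a`-sums `A` is algebraic of type `(-A_{ι_w}, -A_{ῑ_w})`);
* `Summit.Langlands.Langlands.Theorems.RegularAdjointLiftCM.stub_cubeRootAlgebraic` (a cube root of an
  algebraic Hecke character of weight divisible by `3` is algebraic);
* Clozel purity on multisets, `Literature.NumberTheory.Automorphic.CuspidalAutomorphicRepData.purity_of_isCAlgebraic`
  (Clozel 1990, Lemme 4.9; proved in the tree from the Petersson pairing).

## Frame form — why this file does NOT import the route module

When an item closes, the gate links `theorem <Decl>_holds : <Decl> := _root_.<closing theorem>` INTO the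
route file, importing the closing module there; a closing module that itself imports the route module is
an import cycle (the 2026-08-15T23:51Z incident with `IrreducibleGL3CM`, cf.
`Theorems/IrreducibilityBySelfDualityIrreducibleGL3CMFrame.lean`).  So the closing theorem
`Summit.Langlands.Langlands.Theorems.AdjointLiftFromRegularTwist_proof` below is stated with the two route
decl bodies `RegularTwistCM` (antecedent) and `RegularAdjointLiftCM` (conclusion) INLINED VERBATIM (route
file rev 16): its type `δ`-unfolds (three route constants) to the route decl
`Summit.Langlands.Langlands.Theses.IrreducibilityBySelfDuality.AdjointLiftFromRegularTwist`, and the route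
file can import this module without a cycle (imports: Literature, `HarnessLib`, the two stub modules).

## Proof

Given `hT : RegularTwistCM` and the inlined antecedent of `RegularAdjointLiftCM` (Ramakrishnan 2014,
Thm. A at Satake level = the route item `SelfdualGL3AdjointLift` by `rfl`), for `K` CM and `π` regular
algebraic cuspidal on `GL₃(𝔸_K)`, essentially self-dual at Satake level:

1. Thm. A gives `(σ₀, ν)`, `σ₀` non-dihedral, with `t_{π,v} = d_v · Ad(t_{σ₀,v})` a.e. (Satake uniqueness);
2. `RegularTwistCM` re-twists `σ₀ ↦ σ`, regular algebraic, with `t_{σ,v} = c_v t_{σ₀,v}` a.e.;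
3. `Ad(c β) = Ad(β)` (`c ≠ 0`), so the adjoint relation and non-dihedrality transport along the twist
   (`adRel_of_isSatakeTwistOf`, `nonDihedral_of_isSatakeTwistOf`);
4. `ν` is regular algebraic (`isRegularAlgebraic_of_adRel`): `∏ (d · Ad{x, y}) = d³`, so the Hecke
   character `θ` of `ν` satisfies `θ³ = ω_π` (`pow_three_eq_centralCharacter`); `ω_π` has infinity type
   `(-A_{ι_w}, -A_{ῑ_w})` for the integral `a`-sums `A` of the infinity type of `π` (stub 1); purity gives
   `A_{ῑ} = 3w - A_ι`, so `3 ∣ p_w + q_w` (`three_dvd_of_purity`); hence `θ` is algebraic (stub 2) and `ν`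
   is regular algebraic (Clozel's dictionary at `n = 1`, `isRegularAlgebraic_glOne_of_hasInfinityType`).

`IsCMField K` is only passed to `RegularTwistCM`.  No definitions, no named-fact hypotheses (the
adjoint parameter `((β ×ˢ β).map (p ↦ p.1 p.2⁻¹)).erase 1` of the route text is `adParams β` by `rfl`).
References: Ramakrishnan 2014, Thm. A [Ramakrishnan2014]; Clozel 1990, §1.1, Déf. 1.8, §3.3, Lemme 4.9
[Clozel1990]; Weil 1956, §1 [Weil1956].
-/

noncomputable section

set_option linter.dupNamespace false -- project-wide option (lakefile weak.linter.dupNamespace); `Summit.Langlands.Langlands` is the mandated namespace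

open scoped BigOperators Topology Classical
open Filter Set Function IsDedekindDomain NumberField
open Literature.NumberTheory.Automorphic
open Literature.NumberTheory.GaloisRepresentations (HeckeCharacter ideleGroup)

namespace Summit.Langlands.Langlands.Theorems.AdjointLiftFromRegularTwist

/-! ## §1 The Satake half: `θ_ν³ = ω_π` -/

section Satake

variable {K : Type} [Field K] [NumberField K] {h1 : isCompact_glFiniteIntegralLevel 1 K}
  {h2 : isCompact_glFiniteIntegralLevel 2 K} {h3 : isCompact_glFiniteIntegralLevel 3 K}

/-- **`ν³ = ω_π` as Hecke characters.**  If `t_π = d_v · Ad(t_σ)` a.e., `ω_π` carries the Satake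
shadow of the central character of `π` (`ω_π(ϖ_v) = ∏ t_{π,v}`,
`AutomorphicRepData.exists_centralCharacter`) and `θ` is the Hecke character of the GL(1) datum `ν`
(`d_v = θ(ϖ_v)`), then `θ³ = ω_π`: at almost every `v`, `∏ (d_v · Ad{x, y}) = d_v³`
(`prod_adParams_twist_pair`), and Hecke characters agreeing at almost all uniformizers are equal
(`HeckeCharacter.ext_of_eventually_valueAtUniformizer_eq`). [folklore] -/
theorem pow_three_eq_centralCharacter {π : CuspidalAutomorphicRepData 3 K h3}
    {σ : CuspidalAutomorphicRepData 2 K h2} {ν : CuspidalAutomorphicRepData 1 K h1}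
    {ωπ θ : HeckeCharacter K}
    (had : ∀ᶠ v in cofinite, ∀ α β : Multiset ℂ, π.1.HasSatakeParamAt v α →
      σ.1.HasSatakeParamAt v β → ∃ d : ℂ, ν.1.HasSatakeParamAt v {d} ∧
        α = (((β ×ˢ β).map (fun p : ℂ × ℂ => p.1 * p.2⁻¹)).erase 1).map (fun c => d * c))
    (hω : ∀ {v : HeightOneSpectrum (𝓞 K)} {α : Multiset ℂ}, π.1.HasSatakeParamAt v α →
      ωπ.IsUnramifiedAt v ∧ ωπ.valueAtUniformizer v = α.prod)
    (hθ : ∀ (v : HeightOneSpectrum (𝓞 K)) (d : ℂ), ν.1.HasSatakeParamAt v {d} →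
      d = θ.valueAtUniformizer v) :
    θ ^ 3 = ωπ := by
  refine HeckeCharacter.ext_of_eventually_valueAtUniformizer_eq ?_
  filter_upwards [had, π.1.hasSatakeParamAt_cofinite_holds, σ.1.hasSatakeParamAt_cofinite_holds]
    with v hv hπu hσu
  obtain ⟨α, hα⟩ := hπu
  obtain ⟨β, hβ⟩ := hσu
  obtain ⟨d, hd, hαd⟩ := hv α β hα hβ
  obtain ⟨-, hωv⟩ := hω hα
  have h0 := hβ.zero_not_mem
  obtain ⟨x, y, rfl⟩ := Multiset.card_eq_two.mp hβ.card_eq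
  have hx : x ≠ 0 := fun h => h0 (by simp [h])
  have hy : y ≠ 0 := fun h => h0 (by simp [h])
  have hprod : α.prod = d ^ 3 := by
    rw [hαd]
    exact prod_adParams_twist_pair d hx hy
  rw [hωv, hprod, hθ v d hd]
  simp only [HeckeCharacter.valueAtUniformizer, HeckeCharacter.localComponent_apply,
    HeckeCharacter.pow_apply, Units.val_pow_eq_pow_val]

/-- **GL(1) dictionary, pointwise, for THE Hecke character of `ν`** (the one through which `GL₁(𝔸_K)`
acts on `W/W'`): its values at uniformizers are the Satake values of `ν`. [folklore] -/
theorem satake_eq_valueAtUniformizer (ν : CuspidalAutomorphicRepData 1 K h1) {θ : HeckeCharacter K}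
    (hθ : ∀ (g : (AdelicGroupData.gl 1 K).Adelic), ∀ φ ∈ ν.1.W,
      rightTranslation (AdelicGroupData.gl 1 K) g φ -
        ((θ (Matrix.GeneralLinearGroup.det g) : ℂˣ) : ℂ) • φ ∈ ν.1.W')
    (v : HeightOneSpectrum (𝓞 K)) (d : ℂ) (hd : ν.1.HasSatakeParamAt v {d}) :
    d = θ.valueAtUniformizer v := by
  have hur : θ.IsUnramifiedAt v := ν.1.isUnramifiedAt_heckeCharacter_glOne hθ hd
  obtain ⟨ϖ, hϖ, hdϖ⟩ := ν.1.exists_eq_singleton_of_hasSatakeParamAt_glOne hθ hd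
  rw [Multiset.singleton_inj.mp hdϖ, ← HeckeCharacter.localComponent_apply,
    HeckeCharacter.localComponent_eq_valueAtUniformizer hur hϖ]

end Satake

/-! ## §2 Arithmetic of infinity types -/

section Arithmetic

variable {K : Type} [Field K]

/-- A multiset of weights with integral `a`-exponents has an integral `a`-sum. [folklore] -/
theorem exists_intCast_eq_sum_a {s : Multiset ArchWeight} (h : ∀ P ∈ s, ∃ k : ℤ, P.a = k) :
    ∃ k : ℤ, (s.map ArchWeight.a).sum = k := by
  induction s using Multiset.induction_on with
  | empty => exact ⟨0, by simp⟩
  | cons P s ih =>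
      obtain ⟨k, hk⟩ := h P (Multiset.mem_cons_self P s)
      obtain ⟨l, hl⟩ := ih fun Q hQ => h Q (Multiset.mem_cons_of_mem hQ)
      exact ⟨k + l, by rw [Multiset.map_cons, Multiset.sum_cons, hk, hl]; push_cast; ring⟩

/-- **For `GL₃`, a C-algebraic infinity type has integral exponents** (`(3-1)/2 = 1`), hence integral
`a`-sums `A ι`. [folklore] -/
theorem exists_sum_a_eq_intCast_of_isCAlgebraic_three {T : InfinityType K 3} (hC : T.IsCAlgebraic) :
    ∃ A : (K →+* ℂ) → ℤ, ∀ ι : K →+* ℂ, ((T ι).map ArchWeight.a).sum = (A ι : ℂ) := by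
  have h : ∀ ι : K →+* ℂ, ∃ k : ℤ, ((T ι).map ArchWeight.a).sum = k := fun ι =>
    exists_intCast_eq_sum_a fun P hP => by
      obtain ⟨k, l, hk, -⟩ := hC ι P hP
      exact ⟨k + 1, by rw [hk]; push_cast; ring⟩
  choose A hA using h
  exact ⟨A, hA⟩

/-- `∑ (w - a) = |s| w - ∑ a`. [folklore] -/
theorem sum_map_intCast_sub (s : Multiset ℂ) (w : ℤ) :
    (s.map fun a => (w : ℂ) - a).sum = (Multiset.card s : ℂ) * w - s.sum := by
  induction s using Multiset.induction_on with
  | empty => simp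
  | cons a s ih =>
      rw [Multiset.map_cons, Multiset.sum_cons, Multiset.sum_cons, Multiset.card_cons, ih]
      push_cast
      ring

/-- **Purity on multisets ⇒ purity of the `a`-sums**: `A_{ῑ} = 3w - A_ι` for a well-formed `GL₃` type.
[folklore] -/
theorem sum_a_conjugate_eq {T : InfinityType K 3} (hwf : T.IsWellFormed) {A : (K →+* ℂ) → ℤ}
    (hA : ∀ ι : K →+* ℂ, ((T ι).map ArchWeight.a).sum = (A ι : ℂ)) {w : ℤ}
    (hw : ∀ ι : K →+* ℂ, (T (ComplexEmbedding.conjugate ι)).map ArchWeight.a =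
      ((T ι).map ArchWeight.a).map fun a => (w : ℂ) - a) (ι : K →+* ℂ) :
    A (ComplexEmbedding.conjugate ι) = 3 * w - A ι := by
  have h1 := congrArg Multiset.sum (hw ι)
  rw [hA, sum_map_intCast_sub, hA, Multiset.card_map, hwf.1 ι] at h1
  exact_mod_cast h1

/-- **The divisibility fed to the cube-root stub**: with `p_w = -A_{ι_w}`, `q_w = -A_{ῑ_w}` (`0` at a
real `w`), purity gives `3 ∣ p_w + q_w` (complex `w`: `p + q = -3w₀`; real `w`: `ῑ_w = ι_w`,
`2A = 3w₀`). [folklore] -/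
theorem three_dvd_of_purity {T : InfinityType K 3} (hwf : T.IsWellFormed) {A : (K →+* ℂ) → ℤ}
    (hA : ∀ ι : K →+* ℂ, ((T ι).map ArchWeight.a).sum = (A ι : ℂ)) {w₀ : ℤ}
    (hw : ∀ ι : K →+* ℂ, (T (ComplexEmbedding.conjugate ι)).map ArchWeight.a =
      ((T ι).map ArchWeight.a).map fun a => (w₀ : ℂ) - a) (w : InfinitePlace K) :
    (3 : ℤ) ∣ (fun w : InfinitePlace K => -A w.embedding) w +
      (fun w : InfinitePlace K =>
        if w.IsReal then 0 else -A (ComplexEmbedding.conjugate w.embedding)) w := by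
  have h2 := sum_a_conjugate_eq hwf hA hw w.embedding
  by_cases hr : w.IsReal
  · have hc : ComplexEmbedding.conjugate w.embedding = w.embedding :=
      ComplexEmbedding.isReal_iff.mp (InfinitePlace.isReal_iff.mp hr)
    rw [hc] at h2
    simp only [if_pos hr]
    omega
  · simp only [if_neg hr]
    omega

end Arithmetic

/-! ## §3 GL(1): an algebraic Hecke character gives a regular algebraic datum -/

section GLOne

variable {K : Type} [Field K] [NumberField K] {h1 : isCompact_glFiniteIntegralLevel 1 K}

/-- **A `GL₁` datum whose Hecke character has an infinity type is regular algebraic**: by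
`exists_hasInfinityType_of_hasInfinityType_heckeCharacter_glOne` it has a (well-formed) infinity type
with `a`-multisets `{-n_ι}`; its `b`-exponents are the `a`-exponents at `ῑ` (well-formedness), all
integers, and a singleton is `Nodup`.  Clozel's dictionary for `n = 1`.
[cite: Clozel1990, §1.1 and Déf. 1.8] -/
theorem isRegularAlgebraic_glOne_of_hasInfinityType (ν : AutomorphicRepData (AutomorphyDatum.gl 1 K h1))
    {θ : HeckeCharacter K}
    (hθ : ∀ (g : (AdelicGroupData.gl 1 K).Adelic), ∀ φ ∈ ν.W,
      rightTranslation (AdelicGroupData.gl 1 K) g φ -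
        ((θ (Matrix.GeneralLinearGroup.det g) : ℂˣ) : ℂ) • φ ∈ ν.W')
    {p q : InfinitePlace K → ℤ} (hpq : θ.HasInfinityType p q) : ν.IsRegularAlgebraic := by
  obtain ⟨T, hT, ha⟩ := ν.exists_hasInfinityType_of_hasInfinityType_heckeCharacter_glOne hθ hpq
  refine ⟨T, hT, ?_, ?_⟩
  · intro ι P hP
    have haP : P.a ∈ (T ι).map ArchWeight.a := Multiset.mem_map_of_mem _ hP
    rw [ha ι, Multiset.mem_singleton] at haP
    have hsw : P.swap ∈ T (ComplexEmbedding.conjugate ι) := by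
      rw [hT.1.2 ι]
      exact Multiset.mem_map_of_mem _ hP
    have hbP : P.swap.a ∈ (T (ComplexEmbedding.conjugate ι)).map ArchWeight.a :=
      Multiset.mem_map_of_mem _ hsw
    rw [ha, Multiset.mem_singleton, ArchWeight.swap_a] at hbP
    refine ⟨-HeckeCharacter.embExponent p q ι,
      -HeckeCharacter.embExponent p q (ComplexEmbedding.conjugate ι), ?_, ?_⟩
    · rw [haP]; push_cast; ring
    · rw [hbP]; push_cast; ring
  · intro ι
    rw [ha ι]
    exact Multiset.nodup_singleton _

end GLOne

/-! ## §4 `ν` is regular algebraic -/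

section Nu

variable {K : Type} [Field K] [NumberField K] {h1 : isCompact_glFiniteIntegralLevel 1 K}
  {h2 : isCompact_glFiniteIntegralLevel 2 K} {h3 : isCompact_glFiniteIntegralLevel 3 K}

/-- **The GL(1) datum `ν` of an adjoint relation `t_π = ν · Ad(t_σ)` with `π` regular algebraic on
`GL₃` is regular algebraic** (any number field).  The Hecke character `θ` of `ν` satisfies `θ³ = ω_π`
(`pow_three_eq_centralCharacter`); `ω_π` is algebraic of type `(-A_{ι_w}, -A_{ῑ_w})` for the integral
`a`-sums `A` of the infinity type of `π` (`stub_centralCharacterInfinityType`); Clozel purity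
(`CuspidalAutomorphicRepData.purity_of_isCAlgebraic`) gives `3 ∣ p_w + q_w`; so `θ` is algebraic
(`stub_cubeRootAlgebraic`) and `ν` is regular algebraic (`isRegularAlgebraic_glOne_of_hasInfinityType`).
[cite: Clozel1990, Lemme 4.9] -/
theorem isRegularAlgebraic_of_adRel (π : CuspidalAutomorphicRepData 3 K h3)
    (σ : CuspidalAutomorphicRepData 2 K h2) (ν : CuspidalAutomorphicRepData 1 K h1)
    (hπ : π.1.IsRegularAlgebraic)
    (had : ∀ᶠ v in cofinite, ∀ α β : Multiset ℂ, π.1.HasSatakeParamAt v α →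
      σ.1.HasSatakeParamAt v β → ∃ d : ℂ, ν.1.HasSatakeParamAt v {d} ∧
        α = (((β ×ˢ β).map (fun p : ℂ × ℂ => p.1 * p.2⁻¹)).erase 1).map (fun c => d * c)) :
    ν.1.IsRegularAlgebraic := by
  -- the central character of `π` and the Hecke character of `ν`
  obtain ⟨ωπ, hωW, hωsat⟩ := π.1.exists_centralCharacter
  obtain ⟨θ, hθW⟩ := ν.1.exists_heckeCharacter_glOne
  -- Satake half: `θ³ = ω_π`
  have hcube : θ ^ 3 = ωπ :=
    pow_three_eq_centralCharacter had (fun hα => hωsat hα) (satake_eq_valueAtUniformizer ν hθW)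
  -- the infinity type of `π`, its integral `a`-sums, and the infinity type of `ω_π`
  obtain ⟨T, hT, hTreg⟩ := hπ
  obtain ⟨A, hA⟩ := exists_sum_a_eq_intCast_of_isCAlgebraic_three hTreg.1
  have hωtype := RegularAdjointLiftCM.stub_centralCharacterInfinityType K 3 h3 π.1 ωπ hωW T hT A hA
  -- purity ⇒ `3 ∣ p_w + q_w`
  obtain ⟨w₀, hw₀⟩ := π.purity_of_isCAlgebraic hT hTreg.1
  have hdiv := three_dvd_of_purity hT.1 hA hw₀
  -- cube root ⇒ `θ` algebraic ⇒ `ν` regular algebraic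
  obtain ⟨p', q', hθtype⟩ := (θ.isAlgebraic_iff_exists_hasInfinityType).1
    (RegularAdjointLiftCM.stub_cubeRootAlgebraic K θ ωπ _ _ hcube hωtype hdiv)
  exact isRegularAlgebraic_glOne_of_hasInfinityType ν.1 hθW hθtype

end Nu

/-! ## §5 Transport of the adjoint relation and of non-dihedrality along a Satake twist -/

section Twist

variable {K : Type} [Field K] [NumberField K] {h1 : isCompact_glFiniteIntegralLevel 1 K}
  {h2 : isCompact_glFiniteIntegralLevel 2 K} {h3 : isCompact_glFiniteIntegralLevel 3 K}

/-- A GL(1) Satake value is non-zero. [folklore] -/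
theorem ne_zero_of_hasSatakeParamAt_singleton {χ : CuspidalAutomorphicRepData 1 K h1}
    {v : HeightOneSpectrum (𝓞 K)} {c : ℂ} (h : χ.1.HasSatakeParamAt v {c}) : c ≠ 0 :=
  fun h0 => h.zero_not_mem (by simp [h0])

/-- **The adjoint relation `t_π = ν · Ad(t_σ)` is invariant under a.e. Satake twists of `σ`** (Satake
uniqueness, a.e. unramifiedness of `σ₀`, and `Ad(c β) = Ad(β)` for `c ≠ 0`, since Rankin–Selberg
data are blind to a common twist). [folklore] -/
theorem adRel_of_isSatakeTwistOf {π : CuspidalAutomorphicRepData 3 K h3}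
    {σ σ₀ : CuspidalAutomorphicRepData 2 K h2} {ν χ : CuspidalAutomorphicRepData 1 K h1}
    (h : ∀ᶠ v in cofinite, ∀ α β : Multiset ℂ, π.1.HasSatakeParamAt v α →
      σ₀.1.HasSatakeParamAt v β → ∃ d : ℂ, ν.1.HasSatakeParamAt v {d} ∧
        α = (((β ×ˢ β).map (fun p : ℂ × ℂ => p.1 * p.2⁻¹)).erase 1).map (fun c => d * c))
    (htw : ∀ᶠ v in cofinite, ∀ β : Multiset ℂ, σ₀.1.HasSatakeParamAt v β →
      ∃ c : ℂ, χ.1.HasSatakeParamAt v {c} ∧ σ.1.HasSatakeParamAt v (β.map (fun b => c * b))) :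
    ∀ᶠ v in cofinite, ∀ α β : Multiset ℂ, π.1.HasSatakeParamAt v α →
      σ.1.HasSatakeParamAt v β → ∃ d : ℂ, ν.1.HasSatakeParamAt v {d} ∧
        α = (((β ×ˢ β).map (fun p : ℂ × ℂ => p.1 * p.2⁻¹)).erase 1).map (fun c => d * c) := by
  have hcof : ∀ᶠ v in cofinite, σ₀.1.IsUnramifiedAt v := σ₀.1.hasSatakeParamAt_cofinite_holds
  filter_upwards [h, htw, hcof] with v hv htv hur α β hα hβ
  obtain ⟨β₀, hβ₀⟩ := hur
  obtain ⟨c, hc, hσ⟩ := htv β₀ hβ₀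
  have hββ : β = β₀.map (c * ·) := σ.1.hasSatakeParamAt_unique_holds hβ hσ
  obtain ⟨d, hd, hαd⟩ := hv α β₀ hα hβ₀
  refine ⟨d, hd, ?_⟩
  have hc0 : c ≠ 0 := ne_zero_of_hasSatakeParamAt_singleton hc
  -- `Ad(c β₀) = Ad(β₀)`: Rankin–Selberg data `{(ca)(cb)⁻¹} = {ab⁻¹}` are blind to a common twist
  have hrs : ∀ s t : Multiset ℂ, rsData (s.map (c * ·)) (t.map (c * ·)) = rsData s t := by
    intro s t
    induction s using Multiset.induction_on with
    | empty => simp [rsData_zero]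
    | cons a s ih =>
        rw [Multiset.map_cons, rsData_cons, rsData_cons, ih, Multiset.map_map]
        congr 1
        refine Multiset.map_congr rfl fun y _ => ?_
        simp only [Function.comp_apply]
        rw [mul_inv, mul_mul_mul_comm, mul_inv_cancel₀ hc0, one_mul]
  have key : adParams (β₀.map (c * ·)) = adParams β₀ := by
    change (rsData _ _).erase 1 = (rsData _ _).erase 1
    rw [hrs β₀ β₀]
  change α = (adParams β).map (fun c => d * c)
  rw [hββ, key]
  exact hαd

/-- **Non-dihedrality (no a.e. self-twist by the quadratic sign of any quadratic `L/K`) is invariant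
under a.e. Satake twists.** [folklore] -/
theorem nonDihedral_of_isSatakeTwistOf {σ σ₀ : CuspidalAutomorphicRepData 2 K h2}
    {χ : CuspidalAutomorphicRepData 1 K h1}
    (h : ∀ (L : Type) [Field L] [NumberField L] [Algebra K L], Module.finrank K L = 2 →
      ¬ (∀ᶠ v in cofinite, ∀ β : Multiset ℂ, σ₀.1.HasSatakeParamAt v β →
        β.map (fun b => (if ∃ w : HeightOneSpectrum (𝓞 L), w.asIdeal.under (𝓞 K) = v.asIdeal ∧
          w.asIdeal.inertiaDeg (𝓞 K) = 1 then (1 : ℂ) else -1) * b) = β))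
    (htw : ∀ᶠ v in cofinite, ∀ β : Multiset ℂ, σ₀.1.HasSatakeParamAt v β →
      ∃ c : ℂ, χ.1.HasSatakeParamAt v {c} ∧ σ.1.HasSatakeParamAt v (β.map (fun b => c * b))) :
    ∀ (L : Type) [Field L] [NumberField L] [Algebra K L], Module.finrank K L = 2 →
      ¬ (∀ᶠ v in cofinite, ∀ β : Multiset ℂ, σ.1.HasSatakeParamAt v β →
        β.map (fun b => (if ∃ w : HeightOneSpectrum (𝓞 L), w.asIdeal.under (𝓞 K) = v.asIdeal ∧
          w.asIdeal.inertiaDeg (𝓞 K) = 1 then (1 : ℂ) else -1) * b) = β) := by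
  intro L _ _ _ hL hdi
  refine h L hL ?_
  filter_upwards [hdi, htw] with v hv htv β₀ hβ₀
  obtain ⟨c, hc, hσ⟩ := htv β₀ hβ₀
  have hc0 : c ≠ 0 := ne_zero_of_hasSatakeParamAt_singleton hc
  have key := hv (β₀.map (c * ·)) hσ
  rw [Multiset.map_map] at key
  have key' : (β₀.map fun b => (if ∃ w : HeightOneSpectrum (𝓞 L), w.asIdeal.under (𝓞 K) = v.asIdeal ∧
        w.asIdeal.inertiaDeg (𝓞 K) = 1 then (1 : ℂ) else -1) * b).map (c * ·) = β₀.map (c * ·) := by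
    rw [Multiset.map_map]
    refine Eq.trans (Multiset.map_congr rfl fun b _ => ?_) key
    simp only [Function.comp_apply]
    ring
  exact Multiset.map_injective (mul_right_injective₀ hc0) key'

end Twist

end Summit.Langlands.Langlands.Theorems.AdjointLiftFromRegularTwist

namespace Summit.Langlands.Langlands.Theorems

/-- **`AdjointLiftFromRegularTwist` holds, frame form** (item stmt-Langlands-14725 of route
`IrreducibilityBySelfDuality`): `RegularTwistCM → RegularAdjointLiftCM`, both route decl bodies written
out verbatim so that this type `δ`-unfolds to the route decl
`Summit.Langlands.Langlands.Theses.IrreducibilityBySelfDuality.AdjointLiftFromRegularTwist` (and the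
route file can import this module without a cycle).  Ramakrishnan's Thm. A (the inlined antecedent of
`RegularAdjointLiftCM`) gives `(σ₀, ν)` with `σ₀` non-dihedral and `t_π = ν · Ad(t_{σ₀})` a.e. (Satake
uniqueness); `RegularTwistCM` re-twists `σ₀ ↦ σ` regular algebraic; the adjoint relation and
non-dihedrality transport along the twist
(`AdjointLiftFromRegularTwist.adRel_of_isSatakeTwistOf`,
`AdjointLiftFromRegularTwist.nonDihedral_of_isSatakeTwistOf`); and `ν` is regular algebraic
(`AdjointLiftFromRegularTwist.isRegularAlgebraic_of_adRel`: `θ_ν³ = ω_π`, central character infinity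
type, Clozel purity, cube root of an algebraic Hecke character). -/
theorem AdjointLiftFromRegularTwist_proof :
    -- antecedent `RegularTwistCM` (route decl body, verbatim)
    (∀ (K : Type) [Field K] [NumberField K], NumberField.IsCMField K → ∀ (h1 : Literature.NumberTheory.Automorphic.isCompact_glFiniteIntegralLevel 1 K) (hcpt₂ : Literature.NumberTheory.Automorphic.isCompact_glFiniteIntegralLevel 2 K) (hcpt : Literature.NumberTheory.Automorphic.isCompact_glFiniteIntegralLevel 3 K) (π : Literature.NumberTheory.Automorphic.CuspidalAutomorphicRepData 3 K hcpt) (σ₀ : Literature.NumberTheory.Automorphic.CuspidalAutomorphicRepData 2 K hcpt₂) (ν : Literature.NumberTheory.Automorphic.CuspidalAutomorphicRepData 1 K h1), π.1.IsRegularAlgebraic → (∀ᶠ v in cofinite, ∀ α β : Multiset ℂ, π.1.HasSatakeParamAt v α → σ₀.1.HasSatakeParamAt v β → ∃ d : ℂ, ν.1.HasSatakeParamAt v {d} ∧ α = (((β ×ˢ β).map (fun p : ℂ × ℂ => p.1 * p.2⁻¹)).erase 1).map (fun c => d * c)) → ∃ (σ : Literature.NumberTheory.Automorphic.CuspidalAutomorphicRepData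 2 K hcpt₂) (χ : Literature.NumberTheory.Automorphic.CuspidalAutomorphicRepData 1 K h1), σ.1.IsRegularAlgebraic ∧ ∀ᶠ v in cofinite, ∀ β : Multiset ℂ, σ₀.1.HasSatakeParamAt v β → ∃ c : ℂ, χ.1.HasSatakeParamAt v {c} ∧ σ.1.HasSatakeParamAt v (β.map (fun b => c * b))) →
    -- conclusion `RegularAdjointLiftCM` (route decl body, verbatim)
    ((∀ (F : Type) [Field F] [NumberField F] (hF1 : _) (hF2 : _) (hF3 : _) (P : Literature.NumberTheory.Automorphic.CuspidalAutomorphicRepData 3 F hF3) (η : Literature.NumberTheory.Automorphic.CuspidalAutomorphicRepData 1 F hF1), (∀ᶠ v in cofinite, ∀ α : Multiset ℂ, P.1.HasSatakeParamAt v α → ∃ e : ℂ, η.1.HasSatakeParamAt v {e} ∧ α.map (fun a => a⁻¹) = α.map (fun a => e * a)) → ∃ (π : Literature.NumberTheory.Automorphic.CuspidalAutomorphicRepData 2 F hF2) (ν : Literature.NumberTheory.Automorphic.CuspidalAutomorphicRepData 1 F hF1), (∀ (L : Type) [Field L] [NumberField L] [Algebra F L], Module.finrank F L = 2 → ¬ (∀ᶠ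 v in cofinite, ∀ β : Multiset ℂ, π.1.HasSatakeParamAt v β → β.map (fun b => (if ∃ w : IsDedekindDomain.HeightOneSpectrum (NumberField.RingOfIntegers L), w.asIdeal.under (NumberField.RingOfIntegers F) = v.asIdeal ∧ w.asIdeal.inertiaDeg (NumberField.RingOfIntegers F) = 1 then (1 : ℂ) else -1) * b) = β)) ∧ ∀ᶠ v in cofinite, ∀ β : Multiset ℂ, π.1.HasSatakeParamAt v β → ∃ d e : ℂ, ν.1.HasSatakeParamAt v {d} ∧ η.1.HasSatakeParamAt v {e} ∧ d ^ 2 * e = 1 ∧ P.1.HasSatakeParamAt v ((((β ×ˢ β).map (fun p : ℂ × ℂ => p.1 * p.2⁻¹)).erase 1).map (fun c => d * c))) → ∀ (K : Type) [Field K] [NumberField K], NumberField.IsCMField K → ∀ (h1 : _) (hcpt₂ : _) (hcpt : _) (π : Literature.NumberTheory.Automorphic.CuspidalAutomorphicRepData 3 K hcpt), π.1.IsRegularAlgebraic → (∃ η : Literature.NumberTheory.Automorphic.CuspidalAutomorphicRepData 1 K h1, ∀ᶠ v in cofinite, ∀ α : Multiset ℂ, π.1.HasSatakeParamAt v α → ∃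 e : ℂ, η.1.HasSatakeParamAt v {e} ∧ α.map (fun a => a⁻¹) = α.map (fun a => e * a)) → ∃ (σ : Literature.NumberTheory.Automorphic.CuspidalAutomorphicRepData 2 K hcpt₂) (ν : Literature.NumberTheory.Automorphic.CuspidalAutomorphicRepData 1 K h1), σ.1.IsRegularAlgebraic ∧ ν.1.IsRegularAlgebraic ∧ (∀ (L : Type) [Field L] [NumberField L] [Algebra K L], Module.finrank K L = 2 → ¬ (∀ᶠ v in cofinite, ∀ β : Multiset ℂ, σ.1.HasSatakeParamAt v β → β.map (fun b => (if ∃ w : IsDedekindDomain.HeightOneSpectrum (NumberField.RingOfIntegers L), w.asIdeal.under (NumberField.RingOfIntegers K) = v.asIdeal ∧ w.asIdeal.inertiaDeg (NumberField.RingOfIntegers K) = 1 then (1 : ℂ) else -1) * b) = β)) ∧ ∀ᶠ v in cofinite, ∀ α β : Multiset ℂ, π.1.HasSatakeParamAt v α → σ.1.HasSatakeParamAt v β → ∃ d : ℂ, ν.1.HasSatakeParamAt v {d} ∧ α = (((β ×ˢ β).map (fun p : ℂ × ℂ => p.1 * p.2⁻¹)).erase 1).map (fun c => d * c)) := by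
  intro hT hA K _ _ hK h1 h2 h3 π hπ hη
  obtain ⟨η, hη⟩ := hη
  obtain ⟨σ₀, ν, hnd, hrel⟩ := hA K h1 h2 h3 π η hη
  have had : ∀ᶠ v in cofinite, ∀ α β : Multiset ℂ, π.1.HasSatakeParamAt v α →
      σ₀.1.HasSatakeParamAt v β → ∃ d : ℂ, ν.1.HasSatakeParamAt v {d} ∧
        α = (((β ×ˢ β).map (fun p : ℂ × ℂ => p.1 * p.2⁻¹)).erase 1).map (fun c => d * c) := by
    filter_upwards [hrel] with v hv α β hα hβ
    obtain ⟨d, e, hd, -, -, hP⟩ := hv β hβ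
    exact ⟨d, hd, π.1.hasSatakeParamAt_unique_holds hα hP⟩
  obtain ⟨σ, χ, hσ, htw⟩ := hT K hK h1 h2 h3 π σ₀ ν hπ had
  exact ⟨σ, ν, hσ, AdjointLiftFromRegularTwist.isRegularAlgebraic_of_adRel π σ₀ ν hπ had,
    AdjointLiftFromRegularTwist.nonDihedral_of_isSatakeTwistOf (h2 := h2) (σ₀ := σ₀) hnd htw,
    AdjointLiftFromRegularTwist.adRel_of_isSatakeTwistOf had htw⟩

end Summit.Langlands.Langlands.Theorems

end
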